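import Mathlib
import Literature.Computability.AlgebraicComplexity.Hyperdeterminant
import Literature.Computability.AlgebraicComplexity.LinSubst

/-! # `DetqpThesis` (stmt-ValiantsHypothesis-0315), line `four-dimensional-determinant` — stub B2s: the four-Borel group `H(n,m,ι)` stabilises the padded four-dimensional determinant `X₀₀^{m-n} · Det_n(X_ι)` (GKZ Ch.14 Prop 1.4: `Det((M_0,…,M_{ℓ-1})·A) = (∏_r det M_r) Det(A)`) -/
noncomputable section
set_option linter.dupNamespace false
namespace Summit.ValiantsHypothesis.ValiantsHypothesis.Theorems.DetQPDetqpThesis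
open Literature.Computability.AlgebraicComplexity MvPolynomial
open scoped BigOperators Matrix

variable {R : Type*} [CommRing R] {ℓ kk : ℕ}

/-- Family slot action in no slot is the identity:
`∑_J [J = I off ∅] (∏_{r ∈ ∅} (M_r)_{I_r J_r}) A(J) = A(I)`. -/
theorem stabH_slotsMulF_empty (Ms : Fin ℓ → Matrix (Fin kk) (Fin kk) R)
    (A : (Fin ℓ → Fin kk) → R) :
    (fun I => ∑ J : Fin ℓ → Fin kk,
      (if ∀ j, j ∉ (∅ : Finset (Fin ℓ)) → J j = I j
        then ∏ r ∈ (∅ : Finset (Fin ℓ)), Ms r (I r) (J r) else 0) * A J) = A := by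
  classical
  funext I
  rw [Finset.sum_eq_single I]
  · simp
  · intro J _ hJ
    rw [if_neg, zero_mul]
    intro h
    exact hJ (funext fun j => h j (Finset.notMem_empty j))
  · exact fun h => absurd (Finset.mem_univ I) h

/-- Adding a slot to the family action: `M_r ⋆_r ((M_s)_{s ∈ S} ⋆_S A) = (M_s)_{s ∈ insert r S} ⋆ A`
for `r ∉ S` (the family version of `slotMul_slotsMul`). -/
theorem stabH_slotMul_slotsMulF {S : Finset (Fin ℓ)} {r : Fin ℓ} (hr : r ∉ S)
    (Ms : Fin ℓ → Matrix (Fin kk) (Fin kk) R) (A : (Fin ℓ → Fin kk) → R) :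
    slotMul r (Ms r) (fun I => ∑ J : Fin ℓ → Fin kk,
      (if ∀ j, j ∉ S → J j = I j then ∏ s ∈ S, Ms s (I s) (J s) else 0) * A J) =
    fun I => ∑ J : Fin ℓ → Fin kk,
      (if ∀ j, j ∉ insert r S → J j = I j
        then ∏ s ∈ insert r S, Ms s (I s) (J s) else 0) * A J := by
  classical
  funext I
  simp only [slotMul, Finset.mul_sum]
  rw [Finset.sum_comm]
  refine Finset.sum_congr rfl fun J _ => ?_
  -- group the `a`-sum: only `a = J r` can contribute
  rw [Finset.sum_eq_single (J r)]
  · by_cases hJ : ∀ j, j ∉ insert r S → J j = I j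
    · have hJ' : ∀ j, j ∉ S → J j = Function.update I r (J r) j := by
        intro j hj
        by_cases hjr : j = r
        · subst hjr; simp
        · rw [Function.update_of_ne hjr]
          exact hJ j (by simp [hjr, hj])
      rw [if_pos hJ', if_pos hJ, Finset.prod_insert hr]
      have : ∏ x ∈ S, Ms x (Function.update I r (J r) x) (J x) = ∏ x ∈ S, Ms x (I x) (J x) :=
        Finset.prod_congr rfl fun x hx => by
          have hxr : x ≠ r := fun h => hr (h ▸ hx)
          have hx' : Function.update I r (J r) x = I x := Function.update_of_ne hxr ..
          simp only [hx']
      rw [this]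
      ring
    · rw [if_neg hJ, zero_mul]
      by_cases hJ' : ∀ j, j ∉ S → J j = Function.update I r (J r) j
      · exfalso
        apply hJ
        intro j hj
        rw [Finset.mem_insert, not_or] at hj
        have := hJ' j hj.2
        rwa [Function.update_of_ne hj.1] at this
      · rw [if_neg hJ']
        simp
  · intro a _ ha
    rw [if_neg]
    · simp
    · intro h
      have := h r hr
      rw [Function.update_self] at this
      exact ha this.symm
  · exact fun h => absurd (Finset.mem_univ _) h

/-- **Multiplicativity of the family action**: `Det((M_s)_{s ∈ S} ⋆_S A) = (∏_{s ∈ S} det M_s) Det(A)`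
(the family version of `hyperdet_slotsMul`; GKZ Ch. 14, Prop. 1.4). -/
theorem stabH_hyperdet_slotsMulF (S : Finset (Fin ℓ)) (Ms : Fin ℓ → Matrix (Fin kk) (Fin kk) R)
    (A : (Fin ℓ → Fin kk) → R) :
    hyperdet (fun I => ∑ J : Fin ℓ → Fin kk,
      (if ∀ j, j ∉ S → J j = I j then ∏ s ∈ S, Ms s (I s) (J s) else 0) * A J) =
    (∏ s ∈ S, (Ms s).det) * hyperdet A := by
  classical
  induction S using Finset.induction_on with
  | empty => rw [stabH_slotsMulF_empty, Finset.prod_empty, one_mul]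
  | insert r S hr ih =>
    rw [← stabH_slotMul_slotsMulF hr, hyperdet_slotMul, ih, Finset.prod_insert hr]
    ring

/-- **`Det((M_0, …, M_{ℓ-1}) · A) = (∏_r det M_r) Det(A)`**: the hyperdeterminant is a relative
invariant of the product of `ℓ` copies of `GL_k` acting slot by slot (GKZ Ch. 14, Prop. 1.4; the
family version of `hyperdet_tensorMul`). -/
theorem stabH_hyperdet_family (Ms : Fin ℓ → Matrix (Fin kk) (Fin kk) R)
    (A : (Fin ℓ → Fin kk) → R) :
    hyperdet (fun I => ∑ J : Fin ℓ → Fin kk, (∏ r, Ms r (I r) (J r)) * A J) =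
    (∏ r, (Ms r).det) * hyperdet A := by
  rw [← stabH_hyperdet_slotsMulF Finset.univ Ms A]
  congr 1
  funext I
  refine Finset.sum_congr rfl fun J _ => ?_
  rw [if_pos fun j hj => absurd (Finset.mem_univ j) hj]

/-- **Stub B2s — `H(n,m,ι) ⊆ Stab(X₀₀^{m-n} Det_n(X_ι))`.** A substitution `M` whose used columns
are the Kronecker product of four upper triangular matrices `a_0, …, a_3` (placed along `ι`), whose
padding column is `X₀₀ ↦ M₀₀,₀₀ X₀₀`, and whose character `M₀₀,₀₀^{m-n} ∏_r det a_r` is `1`, fixes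
the padded four-dimensional determinant. -/
theorem stub_stabH (n m : ℕ) [NeZero m]
    (ι : (Fin 4 → Fin n) → Fin m × Fin m) (hι : Function.Injective ι)
    (_hℓ : ((0 : Fin m), (0 : Fin m)) ∉ Set.range ι)
    (M : Matrix (Fin m × Fin m) (Fin m × Fin m) ℂ)
    (h1 : ∃ a : Fin 4 → Matrix (Fin n) (Fin n) ℂ,
        (∀ (r : Fin 4) (i j : Fin n), j < i → a r i j = 0) ∧
        (∀ I I' : Fin 4 → Fin n, M (ι I') (ι I) = ∏ r, a r (I' r) (I r)) ∧
        M (0, 0) (0, 0) ^ (m - n) * ∏ r, ∏ i, a r i i = 1)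
    (h2 : ∀ (I : Fin 4 → Fin n) (p : Fin m × Fin m), p ∉ Set.range ι → M p (ι I) = 0)
    (h3 : ∀ p : Fin m × Fin m, p ≠ (0, 0) → M p (0, 0) = 0) :
    linSubst (Fin m × Fin m) ℂ M
        (X ((0 : Fin m), (0 : Fin m)) ^ (m - n) *
          rename ι (hyperdet fun I : Fin 4 → Fin n => (X I : MvPolynomial (Fin 4 → Fin n) ℂ))) =
      X ((0 : Fin m), (0 : Fin m)) ^ (m - n) *
        rename ι (hyperdet fun I : Fin 4 → Fin n => (X I : MvPolynomial (Fin 4 → Fin n) ℂ)) := by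
  classical
  obtain ⟨a, hup, hK, hchar⟩ := h1
  -- (A) the padding variable is an eigenvector
  have hA : linSubst (Fin m × Fin m) ℂ M (X ((0 : Fin m), (0 : Fin m))) =
      M (0, 0) (0, 0) • (X ((0 : Fin m), (0 : Fin m)) : MvPolynomial (Fin m × Fin m) ℂ) := by
    rw [linSubst_X, Finset.sum_eq_single ((0 : Fin m), (0 : Fin m))]
    · intro j _ hj
      rw [h3 j hj, zero_smul]
    · exact fun h => absurd (Finset.mem_univ _) h
  -- (B) the used variables transform by the Kronecker product of the `a_r`
  have hB : ∀ I : Fin 4 → Fin n, linSubst (Fin m × Fin m) ℂ M (X (ι I)) =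
      ∑ I' : Fin 4 → Fin n, (∏ r, a r (I' r) (I r)) •
        (X (ι I') : MvPolynomial (Fin m × Fin m) ℂ) := by
    intro I
    rw [linSubst_X, ← Finset.sum_subset (Finset.subset_univ (Finset.univ.image ι)),
      Finset.sum_image fun x _ y _ h => hι h]
    · exact Finset.sum_congr rfl fun I' _ => by rw [hK]
    · intro j _ hj
      rw [h2 I j ?_, zero_smul]
      rintro ⟨I', hI'⟩
      exact hj (Finset.mem_image.mpr ⟨I', Finset.mem_univ _, hI'⟩)
  -- (C) `rename ι` and `linSubst M` pass through the hyperdeterminant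
  have hren : rename ι (hyperdet fun I : Fin 4 → Fin n => (X I : MvPolynomial (Fin 4 → Fin n) ℂ)) =
      hyperdet fun I : Fin 4 → Fin n => (X (ι I) : MvPolynomial (Fin m × Fin m) ℂ) := by
    have h := map_hyperdet
      ((rename ι : MvPolynomial (Fin 4 → Fin n) ℂ →ₐ[ℂ] MvPolynomial (Fin m × Fin m) ℂ) :
        MvPolynomial (Fin 4 → Fin n) ℂ →+* MvPolynomial (Fin m × Fin m) ℂ)
      (fun I : Fin 4 → Fin n => (X I : MvPolynomial (Fin 4 → Fin n) ℂ))
    simpa only [RingHom.coe_coe, rename_X] using h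
  -- the four transposed matrices, with polynomial (constant) entries
  set Ms : Fin 4 → Matrix (Fin n) (Fin n) (MvPolynomial (Fin m × Fin m) ℂ) :=
    fun r => (C : ℂ →+* MvPolynomial (Fin m × Fin m) ℂ).mapMatrix (a r)ᵀ with hMs
  have hlin : linSubst (Fin m × Fin m) ℂ M
      (hyperdet fun I : Fin 4 → Fin n => (X (ι I) : MvPolynomial (Fin m × Fin m) ℂ)) =
      hyperdet fun I : Fin 4 → Fin n => ∑ J : Fin 4 → Fin n,
        (∏ r, Ms r (I r) (J r)) * (X (ι J) : MvPolynomial (Fin m × Fin m) ℂ) := by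
    have h := map_hyperdet
      ((linSubst (Fin m × Fin m) ℂ M : MvPolynomial (Fin m × Fin m) ℂ →ₐ[ℂ]
        MvPolynomial (Fin m × Fin m) ℂ) :
        MvPolynomial (Fin m × Fin m) ℂ →+* MvPolynomial (Fin m × Fin m) ℂ)
      (fun I : Fin 4 → Fin n => (X (ι I) : MvPolynomial (Fin m × Fin m) ℂ))
    rw [RingHom.coe_coe] at h
    rw [h]
    congr 1
    funext I
    rw [hB I]
    refine Finset.sum_congr rfl fun J _ => ?_
    rw [smul_eq_C_mul, map_prod]
    rfl
  -- (F) `det (C ∘ a_rᵀ) = C (∏_i (a_r)_{ii})`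
  have hdet : ∀ r, (Ms r).det = C (∏ i, a r i i) := by
    intro r
    rw [hMs, ← RingHom.map_det, Matrix.det_transpose,
      Matrix.det_of_upperTriangular fun i j hij => hup r i j hij]
  -- (G) assemble
  rw [map_mul, map_pow, hA, hren, hlin, stabH_hyperdet_family, Finset.prod_congr rfl fun r _ => hdet r,
    ← map_prod C, smul_eq_C_mul, mul_pow, ← C_pow]
  calc C (M (0, 0) (0, 0) ^ (m - n)) * X ((0 : Fin m), (0 : Fin m)) ^ (m - n) *
        (C (∏ r, ∏ i, a r i i) *
          hyperdet fun I : Fin 4 → Fin n => (X (ι I) : MvPolynomial (Fin m × Fin m) ℂ))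
      = C (M (0, 0) (0, 0) ^ (m - n) * ∏ r, ∏ i, a r i i) *
          (X ((0 : Fin m), (0 : Fin m)) ^ (m - n) *
            hyperdet fun I : Fin 4 → Fin n => (X (ι I) : MvPolynomial (Fin m × Fin m) ℂ)) := by
        rw [C_mul]; ring
    _ = _ := by rw [hchar, C_1, one_mul]

end Summit.ValiantsHypothesis.ValiantsHypothesis.Theorems.DetQPDetqpThesis
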